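import Mathlib
import HarnessLib
import Summits.Ventures.LatticeQCDFlow.Scoring.WilsonFlowRK3Consistency

/-!
# The RK3 Wilson flow commutes with the LINK reflection `Θ` (`t ↦ 1 − t`) as well: `Θ = Θ' ∘ T_{e₀}` on configurations, and the integrator is covariant under both

HONEST FRAMING: exact (Metropolis-corrected) sampling algorithms for lattice gauge theory;
figures of merit are autocorrelation/cost numbers at stated couplings and volumes; no
continuum-physics claim.

Venture `LatticeQCDFlow` (cell pub-lqcd), sub-topic `Scoring`, FANOUT row 21 (`su3-base`).  Row 16's
`Scoring/WilsonFlowRK3Reflection` proved the covariance of Lüscher's RK3 integrator under the SITE reflection `Θ'` (`t ↦ −t`),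
`iterate_wilsonFlowRK3_negReflect`, and row 16's `Scoring/WilsonFlowRK3` its covariance under lattice translations,
`iterate_wilsonFlowRK3_siteTranslate`.  The Literature's Osterwalder–Seiler LINK reflection `Θ` (`t ↦ 1 − t`,
`GaugeConfig.timeReflect`, the one that gives reflection positivity for `β ≥ 0` on even tori) is the composite of the two:
this file records that identity and the resulting covariance, so that row 21's flowed-charge reflection-positivity files
(`Exactness/FlowedChargeCorrelatorRP`, hypothesis `hΦΘ` of `integral_flowedCharge_mul_timeReflect_nonpos`) apply to the
engine's flow across the link plane too.  NEW WORK of the cell, def-free; nothing cited as a fact; no number.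

* `timeReflect_eq_negReflect_siteTranslate` — `ΘU = Θ'(T_{e₀} U)` with `(T_a U)(x, μ) = U(x + a, μ)` (Literature
  `GaugeConfig.siteTranslate`): on sites `1 − t = −(t) + 1`, and the reversed temporal link of `Θ` is the one of `Θ'` read on
  the translated field.
* **`wilsonFlowRK3_timeReflect`**, **`iterate_wilsonFlowRK3_timeReflect`** — `RK3_ε^m(ΘU) = Θ(RK3_ε^m U)` for the `SU(n)`
  Wilson flow integrator, every `ε`, `m`.
NOT CLAIMED: anything beyond the covariance identity (its uses are in the `Exactness` files).
-/

noncomputable section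

namespace Summit.Ventures.LatticeQCDFlow.Scoring

open Literature.MathematicalPhysics.QuantumFieldTheory

variable {L n : ℕ}

/-- **`ΘU = Θ'(T_{e₀}U)`**: the link reflection of configurations is the site reflection of the field translated by one unit
of time. -/
theorem timeReflect_eq_negReflect_siteTranslate {G : Type*} [Group G] (U : GaugeConfig 4 L G) :
    U.timeReflect = (U.siteTranslate (Pi.single 0 1)).negReflect := by
  funext e
  obtain ⟨x, μ⟩ := e
  have hsite : ∀ y : Site 4 L, y.timeReflect = y.negReflect + Pi.single 0 1 := fun y => by
    funext k
    by_cases hk : k = 0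
    · subst hk; simp [Site.timeReflect, Site.negReflect]; ring
    · simp [Site.timeReflect, Site.negReflect, hk]
  by_cases hμ : μ = 0
  · subst hμ
    simp only [GaugeConfig.timeReflect, GaugeConfig.negReflect, if_true, GaugeConfig.siteTranslate, hsite]
  · simp only [GaugeConfig.timeReflect, GaugeConfig.negReflect, hμ, if_false, GaugeConfig.siteTranslate, hsite]

/-- **The RK3 step commutes with the link reflection**: `RK3_ε(ΘU) = Θ(RK3_ε U)`. -/
theorem wilsonFlowRK3_timeReflect (ε : ℝ) (U : GaugeConfig 4 L (Matrix.specialUnitaryGroup (Fin n) ℂ)) :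
    wilsonFlowRK3 ε U.timeReflect = (wilsonFlowRK3 ε U).timeReflect := by
  rw [timeReflect_eq_negReflect_siteTranslate, timeReflect_eq_negReflect_siteTranslate, wilsonFlowRK3_negReflect,
    wilsonFlowRK3_siteTranslate]

/-- **Any number of RK3 steps commutes with the link reflection.** -/
theorem iterate_wilsonFlowRK3_timeReflect (ε : ℝ) (m : ℕ) (U : GaugeConfig 4 L (Matrix.specialUnitaryGroup (Fin n) ℂ)) :
    (wilsonFlowRK3 ε)^[m] U.timeReflect = ((wilsonFlowRK3 ε)^[m] U).timeReflect :=
  Function.Commute.iterate_left (g := GaugeConfig.timeReflect) (fun V => wilsonFlowRK3_timeReflect ε V) m U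

end Summit.Ventures.LatticeQCDFlow.Scoring
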